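import Literature.NumberTheory.Transcendental.KZCalculusProofs
import Literature.NumberTheory.Transcendental.KZVolumeConjectureProofs

/-!
# `VolumeFormOffPlane` (stmt-KontsevichZagierPeriods-14935) — negative side II: one move never suffices

Refuter (`cdisprove`, cycle 1) by-product for the crux `VolumeFormOffPlane` of route
`SymplecticScissors` (the frame off the plane: for `N ≠ 2`, two integrand-`1` representations of
dimension `N` with equal value are KZ-equivalent). Route-file-free and definition-free companion of
`Negative/Core.lean`: the refuted natural strengthening "equal-volume integrand-`1` representations
off the plane differ by a SINGLE instance of one of the four rules" (`not_offPlane_oneMove`, stated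
over the verbatim body of the crux with `KZ.Equivalent` replaced by one-move membership).

Witness at `N = 3`, the crux's first open slice: the closed unit cube `[0,1]³` (the three-fold unit
slab over the point `ℝ⁰` of `KZ.IntegralRep.exists_volumeRep_zero`, so compact, integrand `1`,
volume `1` by soundness) and the open unit cube `(0,1)³` (volume `1`). Their difference is no
instance of rule 1a/1b (augmentation: a two-term difference is not a three-term one), of
Newton–Leibniz (it relates two different dimensions; the free group pins the instance to the pair),
nor of rule 2 (its map is differentiable within the compact closed cube at every point, hence
continuous, so the image would be compact — the open cube is not). Hence rule 1a (cuts) is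
load-bearing for the crux and the chain form `KZ.Equivalent` is forced, as for the planar layer
(`PlanarK0InjectiveNegative.not_planarOneMove`). [Kontsevich–Zagier 2001, §1.2; Cresson–Viu-Sos 2022, Problem 2.1]
-/

noncomputable section

open MeasureTheory Set MvPolynomial
open Literature.NumberTheory.Transcendental Literature.ModelTheory.ExponentialFields

namespace Summit.KontsevichZagierPeriods.SymplecticScissors.VolumeFormOffPlaneNegative

/-- AUGMENTATION: a difference of two generators is never a three-term move instance
`of s − of s₁ − of s₂` (the shape of rules 1a, 1b): count generators with sign. [folklore] -/
theorem freeAbelianGroup_of_sub_of_ne_three_term {X : Type*} (a b c d e : X) :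
    FreeAbelianGroup.of a - FreeAbelianGroup.of b ≠
      FreeAbelianGroup.of c - FreeAbelianGroup.of d - FreeAbelianGroup.of e := by
  intro h
  have := congrArg (FreeAbelianGroup.lift fun _ : X => (1:ℤ)) h
  simp only [map_sub, FreeAbelianGroup.lift_apply_of] at this
  omega

/-- The open unit cube `(0,1)ᴺ` is ℚ-semialgebraic (intersection of rational coordinate slabs). [folklore] -/
theorem isSemialgebraic_pi_Ioo_zero_one (N : ℕ) :
    IsSemialgebraic ℚ (Set.pi univ fun _ : Fin N => Ioo (0 : ℝ) 1) := by
  have hcoord : ∀ i : Fin N, IsSemialgebraic ℚ {p : Fin N → ℝ | p i ∈ Ioo (0 : ℝ) 1} := fun i => by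
    have h := (isSemialgebraic_setOf_eval_lt (k := ℚ) (R := ℝ) (ι := Fin N) (C 0) (X i)).inter
      (isSemialgebraic_setOf_eval_lt (k := ℚ) (R := ℝ) (ι := Fin N) (X i) (C 1))
    have hEq : {p : Fin N → ℝ | p i ∈ Ioo (0 : ℝ) 1} =
        {x : Fin N → ℝ | aeval x (C 0 : MvPolynomial (Fin N) ℚ) < aeval x (X i : MvPolynomial (Fin N) ℚ)} ∩
        {x : Fin N → ℝ | aeval x (X i : MvPolynomial (Fin N) ℚ) < aeval x (C 1 : MvPolynomial (Fin N) ℚ)} := by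
      ext p; simp
    rw [hEq]; exact h
  have hEq : (Set.pi univ fun _ : Fin N => Ioo (0 : ℝ) 1) =
      ⋂ i ∈ (Finset.univ : Finset (Fin N)), {p : Fin N → ℝ | p i ∈ Ioo (0 : ℝ) 1} := by
    ext p; simp
  rw [hEq]
  exact IsSemialgebraic.biInter _ _ fun i _ => hcoord i

/-- **ONE MOVE NEVER SUFFICES** — the one-move strengthening of the off-plane frame is false
(witness at `N = 3`: `[0,1]³` vs `(0,1)³`, see the module docstring). [folklore] -/
theorem not_offPlane_oneMove :
    ¬ (∀ N, N ≠ 2 → ∀ (r r' : KZ.IntegralRep N), (∀ x ∈ r.domain, r.integrand x = 1) →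
        (∀ x ∈ r'.domain, r'.integrand x = 1) → r.value = r'.value →
        KZ.of r - KZ.of r' ∈
          KZ.domainAddRel ∪ KZ.integrandAddRel ∪ KZ.changeOfVariablesRel ∪ KZ.newtonLeibnizRel) := by
  intro h
  -- FREE-GROUP PINNING (the tree's `PlanarK0InjectiveNegative.eq_of_of_sub_of_eq`, re-derived
  -- locally because that module sits behind the route file): `of a − of b = of c − of d` with
  -- `a ≠ b` forces `a = c ∧ b = d` — evaluate the counting homomorphisms at `a` and at `b`.
  have pin : ∀ {a b c d : Σ n, KZ.IntegralRep n}, a ≠ b →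
      FreeAbelianGroup.of a - FreeAbelianGroup.of b = FreeAbelianGroup.of c - FreeAbelianGroup.of d →
      a = c ∧ b = d := by
    classical
    intro a b c d hab hcd
    have key : ∀ x : Σ n, KZ.IntegralRep n, ((if a = x then (1:ℤ) else 0) - (if b = x then 1 else 0)) =
        ((if c = x then 1 else 0) - (if d = x then 1 else 0)) := fun x => by
      simpa only [map_sub, FreeAbelianGroup.lift_apply_of] using
        congrArg (FreeAbelianGroup.lift fun y => if y = x then (1:ℤ) else 0) hcd
    have ha := key a
    have hb := key b
    rw [if_pos rfl, if_neg (Ne.symm hab)] at ha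
    rw [if_pos rfl, if_neg hab] at hb
    refine ⟨?_, ?_⟩
    · by_contra hca
      rw [if_neg (show ¬ c = a from fun h => hca h.symm)] at ha
      by_cases hda : d = a
      · rw [if_pos hda] at ha; omega
      · rw [if_neg hda] at ha; omega
    · by_contra hdb
      rw [if_neg (show ¬ d = b from fun h => hdb h.symm)] at hb
      by_cases hcb : c = b
      · rw [if_pos hcb] at hb; omega
      · rw [if_neg hcb] at hb; omega
  -- Lebesgue measure on `ℝ⁰` is the Dirac mass
  have hvol0 : (volume : Measure (Fin 0 → ℝ)) = Measure.dirac default := by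
    rw [MeasureTheory.volume_pi]; exact Measure.pi_of_empty _ _
  -- THE POINT `ℝ⁰` (compact, integrand 1, value 1)
  obtain ⟨C, hCc, hCi, hC1⟩ := KZ.IntegralRep.exists_volumeRep_zero
  have hCuniv : C.domain = univ := Subsingleton.eq_univ_of_nonempty (hCi.mono interior_subset)
  have hCval : C.value = 1 := by
    have hi : C.integrand = fun _ => 1 := funext fun x => hC1 x (hCuniv ▸ mem_univ x)
    simp [KZ.IntegralRep.value, hCuniv, hi, hvol0]
  -- THE CLOSED UNIT CUBE `[0,1]³`: three unit slabs over the point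
  set K : KZ.IntegralRep 3 := ((C.slab 0).slab 0).slab 0 with hK_def
  have hK1 : ∀ x ∈ K.domain, K.integrand x = 1 :=
    ((C.slab 0).slab 0).slab_integrand_eq_one 0
      ((C.slab 0).slab_integrand_eq_one 0 (C.slab_integrand_eq_one 0 hC1))
  have hKc : IsCompact K.domain :=
    ((C.slab 0).slab 0).isCompact_slabDomain 0
      ((C.slab 0).isCompact_slabDomain 0 (C.isCompact_slabDomain 0 hCc))
  have hCK : KZ.Equivalent C K :=
    ((C.equivalent_slab 0).trans ((C.slab 0).equivalent_slab 0)).trans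
      (((C.slab 0).slab 0).equivalent_slab 0)
  have hKval : K.value = 1 := by rw [← KZ.Equivalent.value_eq_holds hCK, hCval]
  have hK0 : (0 : Fin 3 → ℝ) ∈ K.domain := by
    simp [hK_def, KZ.IntegralRep.slab, KZ.IntegralRep.slabDomain, hCuniv, Fin.init]
  -- THE OPEN UNIT CUBE `(0,1)³`
  have hUfin : volume (Set.pi univ fun _ : Fin 3 => Ioo (0 : ℝ) 1) ≠ ⊤ := by
    refine ((measure_mono fun p hp => ?_).trans_lt
      (isCompact_Icc (a := (0 : Fin 3 → ℝ)) (b := 1)).measure_lt_top).ne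
    simp only [mem_pi, mem_univ, mem_Ioo, forall_const] at hp
    exact ⟨fun i => (hp i).1.le, fun i => (hp i).2.le⟩
  set U : KZ.IntegralRep 3 :=
    { domain := Set.pi univ fun _ : Fin 3 => Ioo (0 : ℝ) 1
      integrand := fun _ => 1
      isSemialgebraic_domain := isSemialgebraic_pi_Ioo_zero_one 3
      isSemialgebraicFunOn_integrand :=
        (isSemialgebraicFunOn_natCast (isSemialgebraic_pi_Ioo_zero_one 3) 1).congr fun _ _ => by simp
      integrableOn := integrableOn_const hUfin } with hU_def
  have hUdom : U.domain = Set.pi univ fun _ : Fin 3 => Ioo (0 : ℝ) 1 := rfl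
  have hUint : U.integrand = fun _ => 1 := rfl
  have hUval : U.value = 1 := by
    simp only [KZ.IntegralRep.value, hUdom, hUint, setIntegral_const, smul_eq_mul, mul_one, Measure.real]
    rw [Real.volume_pi_Ioo_toReal (fun _ => zero_le_one)]
    simp
  have hUnc : ¬ IsCompact U.domain := by
    intro hUK
    have hne : U.domain.Nonempty :=
      ⟨fun _ => 1/2, by simp only [hUdom, mem_pi, mem_univ, mem_Ioo, forall_const]; norm_num⟩
    obtain ⟨p, hp, hmin⟩ := hUK.exists_isMinOn hne (continuous_apply 0).continuousOn
    simp only [hUdom, mem_pi, mem_univ, mem_Ioo, forall_const] at hp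
    have hq : Function.update p 0 (p 0 / 2) ∈ U.domain := by
      simp only [hUdom, mem_pi, mem_univ, mem_Ioo, forall_const]
      intro i
      by_cases hi : i = 0
      · subst hi
        simp only [Function.update_self]
        exact ⟨by linarith [(hp 0).1], by linarith [(hp 0).2]⟩
      · rw [Function.update_of_ne hi]
        exact hp i
    have hle := (isMinOn_iff.mp hmin) _ hq
    simp only [Function.update_self] at hle
    linarith [(hp 0).1]
  have hKU : (⟨3, K⟩ : Σ n, KZ.IntegralRep n) ≠ ⟨3, U⟩ := by
    intro h'
    rw [Sigma.mk.inj_iff] at h'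
    have hKU' : K = U := eq_of_heq h'.2
    have h0 : (0 : Fin 3 → ℝ) ∈ U.domain := hKU' ▸ hK0
    simp [hUdom, mem_pi] at h0
  -- the one move
  have hmem := h 3 (by decide) K U hK1 (fun _ _ => rfl) (by rw [hKval, hUval])
  rcases hmem with ((h1a | h1b) | h2) | h3
  · obtain ⟨n, s, s₁, s₂, -, -, -, -, hEq⟩ := h1a
    exact freeAbelianGroup_of_sub_of_ne_three_term _ _ _ _ _ hEq
  · obtain ⟨n, s, s₁, s₂, -, -, -, hEq⟩ := h1b
    exact freeAbelianGroup_of_sub_of_ne_three_term _ _ _ _ _ hEq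
  · obtain ⟨n, r₀, r₀', Φ, Φ', -, hder, -, hdom, -, hEq⟩ := h2
    obtain ⟨e1, e2⟩ := pin hKU hEq
    rw [Sigma.mk.inj_iff] at e1 e2
    obtain ⟨rfl, e1⟩ := e1
    obtain ⟨-, e2⟩ := e2
    have e1' : K = r₀ := eq_of_heq e1
    have e2' : U = r₀' := eq_of_heq e2
    rw [← e1'] at hder hdom
    rw [← e2'] at hdom
    have hcont : ContinuousOn Φ K.domain := fun x hx => (hder x hx).continuousWithinAt
    exact hUnc (hdom ▸ hKc.image_of_continuousOn hcont)
  · obtain ⟨n, s, s', -, -, -, -, -, -, -, -, -, -, -, hEq⟩ := h3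
    obtain ⟨e1, e2⟩ := pin hKU hEq
    rw [Sigma.mk.inj_iff] at e1 e2
    omega

end Summit.KontsevichZagierPeriods.SymplecticScissors.VolumeFormOffPlaneNegative
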